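import Summits.CriticalPhenomena.PercolationContinuityZ3.Theorems.PercNearOneGluingNoHeavyLowerTailSahiMixtureChainBernstein
import Summits.CriticalPhenomena.PercolationContinuityZ3.Theorems.PercNearOneGluingNoHeavyLowerTailSahiMixtureMonotone
import HarnessLib

/-!
# TOP at every order for monotone mixtures of product measures (the instance)

Support file of the one-cut programme (crux `NoHeavyLowerTail`, stmt-CriticalPhenomena-4575; cell `prim-masterthm`, seat P3, gen 15;
`run/shared/lean/prim/prim-masterthm/prim-masterthm-p3/HIERARCHY.md` §23; memo
`run/shared/lean/prim/prim-masterthm/FROM-prim-masterthm-p3-g15-MONOTONE-MIXTURES.md` §3(c)).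
The chain theorem of `…SahiMixtureChainBernstein` applied to the concrete class of `…SahiMixtureMonotone`:
**`bernsteinPos_orCoin_all_of_monotoneMixture`** — for level weights `w ≥ 0` of mass `1` and bit probabilities `y_{l,i} ∈ [0,1]` nondecreasing in the
level, OR-ing an independent coin of bias `h` into ALL of `m` distinct bits gives a Bernstein-positive coin polynomial `h ↦ E_m(μ ⊗ coin(h); 1_{A∪H},…)` of
degree `m`, for EVERY `m` — the conclusion of `TopRowConjecture` (whose hypothesis `E_m ≥ 0` holds here by `sahiE_nonneg_of_monotoneMixture`) on this class,
uniformly in the order.  Special cases: de Finetti exchangeable laws (`…_deFinetti`), nested events (`y ∈ {0,1}`), product laws (`L = 1`).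
HONEST FRAMING: nothing here asserts (M⁺-k) or `C_k` for `k ≥ 3`. Everything PROVED, standard axioms. [this work]
-/

noncomputable section

open scoped Classical

namespace Summit.CriticalPhenomena.PercolationContinuityZ3.Theorems

open Finset Function
open Literature.Combinatorics.Sahi2008
open Literature.Probability.Percolation.DecisionTree (ind)

namespace SahiMixture

variable {L : ℕ} {ι : Type*} [Fintype ι] [DecidableEq ι]

/-- **TOP at every order for monotone mixtures of product measures**: the all-members OR-coin cell of `m` distinct bits is Bernstein-positive of degree `m`,
for every `m`. [this work] -/
theorem bernsteinPos_orCoin_all_of_monotoneMixture (w : Fin L → ℝ) (hw0 : ∀ l, 0 ≤ w l) (hw1 : ∑ l, w l = 1)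
    (y : Fin L → ι → ℝ) (hy0 : ∀ l i, 0 ≤ y l i) (hy1 : ∀ l i, y l i ≤ 1) (hmono : ∀ i, Monotone (fun l => y l i))
    {m : ℕ} (e : Fin m → ι) (he : Function.Injective e) :
    BernsteinPos m (fun h => sahiE (coinWeight (mixProdWeight w y) h) m (fun j => ind (orCoin (bitEv (e j)) true))) := by
  have hμ1 : ∑ x, mixProdWeight w y x = 1 := by rw [sum_mixProdWeight, hw1]
  exact bernsteinPos_orCoin_all_of_chainMoments (mixProdWeight w y) hμ1 (fun j => bitEv (e j)) w hw0 hw1 (fun l j => y l (e j))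
    (fun l j => hy0 l (e j)) (fun l j => hy1 l (e j)) (fun j => hmono (e j))
    (fun _ e' he' => ex_mixProdWeight_prod_ind w y (e ∘ e') (he.comp he')) id injective_id

/-- **de Finetti exchangeable laws**: the all-members OR-coin cell of a mixture of i.i.d. bits (`y_{l,i} = p_l ∈ [0,1]`, `p` nondecreasing) is Bernstein-positive
at every order. [this work] -/
theorem bernsteinPos_orCoin_all_of_deFinetti (w : Fin L → ℝ) (hw0 : ∀ l, 0 ≤ w l) (hw1 : ∑ l, w l = 1)
    (p : Fin L → ℝ) (hp0 : ∀ l, 0 ≤ p l) (hp1 : ∀ l, p l ≤ 1) (hmono : Monotone p) {m : ℕ} (e : Fin m → ι) (he : Function.Injective e) :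
    BernsteinPos m (fun h => sahiE (coinWeight (mixProdWeight w (fun l (_ : ι) => p l)) h) m (fun j => ind (orCoin (bitEv (e j)) true))) :=
  bernsteinPos_orCoin_all_of_monotoneMixture w hw0 hw1 _ (fun l _ => hp0 l) (fun l _ => hp1 l) (fun _ => hmono) e he

end SahiMixture

end Summit.CriticalPhenomena.PercolationContinuityZ3.Theorems

end
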